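import Summits.HodgeConjecture.CorCM.IrreducibleOddWeightsIsotypicCellsIso
import Mathlib.LinearAlgebra.Pi
import Mathlib.LinearAlgebra.Dimension.Constructions
import Mathlib.LinearAlgebra.LinearIndependent.Lemmas
import HarnessLib

/-!
# Isotypic cells, VIII: DENSITY — for an absolutely irreducible stable `A` the diagonal orbit of a linearly
# INDEPENDENT tuple `(b_j) ∈ A^J` spans ALL of `A^J`; the diagonal orbit module of any tuple has dimension
# `dim A · rank(b)`

COR-CM (cell `pub-hodgecm2`, binder seat `b16` gen 70, count-neutral claim ISOTYPIC SPLITTING OF THE DEFECT, file I8 —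
pure linear algebra; theorems only, no definition, no named fact, no `sorry`).  NEW as organised here, hence under
`Summits/`.  HONEST FRAMING: the Jacobson–Burnside DENSITY theorem written in the lane's unbundled shape (one ℚ-space `V`,
a family of operators `T_i` closed under composition and containing the identity — e.g. the translates `f ↦ f(k·)` of a
group action; `A` STABLE, IRREDUCIBLE, with SCALAR COMMUTANT), proved with file I1's complement lemma and equivariant
projections instead of the double commutant theorem; gen 69 Q1 had density for TWO vectors.  It is the tool that turns
file I5's quantisation `d ∣ dim` into an exact COUNT inside an isotypic class (file I9); `HC_CM` is neither used nor
asserted.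

SETTING.  `J` finite; the tuple space `V^J` carries the DIAGONAL operators `T_i^J (f) = (T_i (f j))_j`; the cells
`single_j(A) ≤ V^J` are stable irreducible with `Σ_j single_j(A) = A^J`; the DIAGONAL ORBIT MODULE of a tuple `b ∈ A^J`
is `𝔐(b) = span{(T_i b_j)_j : i}` — for the translates of a `G`-set and `b` the components of a shadow in an isotypic
class, `dim 𝔐(b) = dim S(Σ_j ι_j b_j)` (file I9).

* §1 Images of stable irreducibles under intertwiners are stable irreducible (`map_irreducible_of_intertwine`); the
  cells `single_j(A)`; the diagonal orbit module is stable and every element of it is `(φ b_j)_j` for one linear `φ`.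
* §2 **DENSITY** (`span_diag_orbit_eq_pi_of_linearIndependent`): `A` stable irreducible with scalar commutant,
  `b : J → A` LINEARLY INDEPENDENT ⟹ **`𝔐(b) = A^J`**: otherwise a complementary cell `single_s(A)` of `𝔐(b)` (file I1
  §3) and the equivariant projection onto it (file I1 §5) give scalars `c_j` (the commutant) with `Σ_j c_j b_j = 0`,
  `c_s = 1`.
* §3 **THE DIMENSION OF A DIAGONAL ORBIT MODULE** (`finrank_span_diag_orbit_eq_mul`): for ANY tuple `b : J → A`,
  **`dim 𝔐(b) = rank(b) · dim A`**, `rank(b) = dim span{b_j}` (restrict to a maximal independent sub-tuple: the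
  restriction is injective on `𝔐(b)` because its elements are `(φ b_j)_j`).

## References

* [Lang2002] S. Lang, *Algebra*, 3rd ed., XVII §3 (the density theorem; Burnside's theorem, Cor. 3.3–3.4).
* [CurtisReiner1962] C. W. Curtis, I. Reiner, *Representation Theory of Finite Groups and Associative Algebras*, §27
  (Burnside's theorem).
* [Serre1977] J.-P. Serre, *Linear Representations of Finite Groups*, GTM 42, §2.2, §2.6.
-/

set_option autoImplicit false

noncomputable section

open scoped BigOperators Classical

universe u u' v v₂ w

namespace Summit.HodgeConjecture.CorCM.IrrOdd

variable {V : Type v} [AddCommGroup V] [Module ℚ V] {ι : Type w} (T : ι → V →ₗ[ℚ] V)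

/-! ### §1 Intertwiners, cells of the tuple space, the diagonal orbit module -/

/-- **THE IMAGE OF A STABLE IRREDUCIBLE UNDER AN INTERTWINER IS STABLE IRREDUCIBLE** (for the target operators): if
`Θ (T_i a) = T′_i (Θ a)` on `A`, then `Θ(A)` is `T′`-stable, and every non-zero `T′`-stable `W ≤ Θ(A)` is `Θ(A)` (its
preimage in `A` is stable and non-zero). [cite: Serre1977, §2.2] -/
theorem map_irreducible_of_intertwine {V' : Type v₂} [AddCommGroup V'] [Module ℚ V'] (T' : ι → V' →ₗ[ℚ] V')
    (Θ : V →ₗ[ℚ] V') {A : Submodule ℚ V} (hAst : ∀ (i : ι) (v : V), v ∈ A → T i v ∈ A)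
    (hAirr : ∀ W : Submodule ℚ V, W ≤ A → W ≠ ⊥ → (∀ (i : ι) (v : V), v ∈ W → T i v ∈ W) → W = A)
    (hΘ : ∀ (i : ι) (a : V), a ∈ A → Θ (T i a) = T' i (Θ a)) :
    (∀ (i : ι) (v : V'), v ∈ A.map Θ → T' i v ∈ A.map Θ) ∧
      ∀ W : Submodule ℚ V', W ≤ A.map Θ → W ≠ ⊥ → (∀ (i : ι) (v : V'), v ∈ W → T' i v ∈ W) → W = A.map Θ := by
  refine ⟨?_, fun W hW hW0 hWst => ?_⟩
  · rintro i _ ⟨a, ha, rfl⟩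
    exact ⟨T i a, hAst i a ha, hΘ i a ha⟩
  · have hpre : W.comap Θ ⊓ A = A := by
      refine hAirr _ inf_le_right (fun h => hW0 ?_) (fun i a ha => ⟨?_, hAst i a ha.2⟩)
      · rw [eq_bot_iff]
        intro c hc
        obtain ⟨a, ha, rfl⟩ := Submodule.mem_map.1 (hW hc)
        have hmem : a ∈ W.comap Θ ⊓ A := ⟨hc, ha⟩
        rw [h, Submodule.mem_bot] at hmem
        rw [hmem, map_zero]
        exact Submodule.zero_mem _
      · show Θ (T i a) ∈ W
        rw [hΘ i a ha.2]
        exact hWst i _ ha.1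
    refine le_antisymm hW ?_
    rintro _ ⟨a, ha, rfl⟩
    have ha' : a ∈ W.comap Θ ⊓ A := by rw [hpre]; exact ha
    exact ha'.1

/-- `single_j` intertwines `T_i` with the diagonal operator `T_i^J`. [folklore] -/
theorem compLeft_single {J : Type u} [DecidableEq J] (i : ι) (j : J) (a : V) :
    (T i).compLeft J (LinearMap.single ℚ (fun _ : J => V) j a) = LinearMap.single ℚ (fun _ : J => V) j (T i a) := by
  ext j'
  simp only [LinearMap.compLeft_apply, Function.comp_apply, LinearMap.coe_single]
  exact Pi.apply_single (fun _ => T i) (fun _ => map_zero (T i)) j a j'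

/-- The cells `single_j(A)` of a stable irreducible `A` are stable irreducible for the diagonal operators.
[cite: Serre1977, §2.6] -/
theorem single_cell_irreducible {J : Type u} [DecidableEq J] {A : Submodule ℚ V}
    (hAst : ∀ (i : ι) (v : V), v ∈ A → T i v ∈ A)
    (hAirr : ∀ W : Submodule ℚ V, W ≤ A → W ≠ ⊥ → (∀ (i : ι) (v : V), v ∈ W → T i v ∈ W) → W = A) (j : J) :
    (∀ (i : ι) (f : J → V), f ∈ A.map (LinearMap.single ℚ (fun _ : J => V) j) →
        (T i).compLeft J f ∈ A.map (LinearMap.single ℚ (fun _ : J => V) j)) ∧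
      ∀ W : Submodule ℚ (J → V), W ≤ A.map (LinearMap.single ℚ (fun _ : J => V) j) → W ≠ ⊥ →
        (∀ (i : ι) (f : J → V), f ∈ W → (T i).compLeft J f ∈ W) → W = A.map (LinearMap.single ℚ (fun _ : J => V) j) :=
  map_irreducible_of_intertwine T (fun i => (T i).compLeft J) (LinearMap.single ℚ (fun _ : J => V) j) hAst hAirr
    fun i a _ => (compLeft_single T i j a).symm

/-- The diagonal orbit module `𝔐(b) = span{(T_i b_j)_j}` is stable under the diagonal operators when the family `T` is
closed under composition. [folklore] -/
theorem span_diag_orbit_stable (hmul : ∀ i i' : ι, ∃ i'' : ι, T i'' = T i ∘ₗ T i') {J : Type u} (b : J → V) :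
    ∀ (i : ι) (f : J → V), f ∈ Submodule.span ℚ (Set.range fun i : ι => fun j : J => T i (b j)) →
      (T i).compLeft J f ∈ Submodule.span ℚ (Set.range fun i : ι => fun j : J => T i (b j)) := by
  intro i f hf
  have hmap := (Submodule.map_span_le ((T i).compLeft J) (Set.range fun i : ι => fun j : J => T i (b j))
    (Submodule.span ℚ (Set.range fun i : ι => fun j : J => T i (b j)))).2 (by
      rintro _ ⟨i', rfl⟩
      obtain ⟨i'', hi''⟩ := hmul i i'
      refine Submodule.subset_span ⟨i'', ?_⟩
      funext j
      simp [LinearMap.compLeft_apply, hi''])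
  exact hmap (Submodule.mem_map_of_mem hf)

/-- Every element of `𝔐(b)` is `(φ b_j)_j` for ONE linear `φ : V → V`. [folklore] -/
theorem exists_linearMap_of_mem_span_diag_orbit {J : Type u} (b : J → V) {f : J → V}
    (hf : f ∈ Submodule.span ℚ (Set.range fun i : ι => fun j : J => T i (b j))) :
    ∃ φ : V →ₗ[ℚ] V, f = fun j => φ (b j) := by
  induction hf using Submodule.span_induction with
  | mem f hf =>
    obtain ⟨i, rfl⟩ := hf
    exact ⟨T i, rfl⟩
  | zero => exact ⟨0, funext fun j => by simp⟩
  | add f f' _ _ hf hf' =>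
    obtain ⟨φ, rfl⟩ := hf
    obtain ⟨φ', rfl⟩ := hf'
    exact ⟨φ + φ', funext fun j => by simp⟩
  | smul t f _ hf =>
    obtain ⟨φ, rfl⟩ := hf
    exact ⟨t • φ, funext fun j => by simp⟩

/-! ### §2 Density -/

/-- **DENSITY.**  `T` closed under composition and containing the identity; `A` stable, irreducible, with SCALAR
COMMUTANT (every linear `L : V → V` preserving `A` and commuting with the `T_i` on `A` is a scalar on `A`); `b : J → V` a
LINEARLY INDEPENDENT tuple of elements of `A`.  Then the diagonal orbit module is everything:
**`span{(T_i b_j)_j : i} = A^J`**.  (Jacobson–Burnside: the operators `T_i|_A` span `End_ℚ(A)`.)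
[cite: Lang2002, XVII §3] [cite: CurtisReiner1962, §27] -/
theorem span_diag_orbit_eq_pi_of_linearIndependent (h1 : ∃ i₀ : ι, T i₀ = LinearMap.id)
    (hmul : ∀ i i' : ι, ∃ i'' : ι, T i'' = T i ∘ₗ T i') {A : Submodule ℚ V} [FiniteDimensional ℚ A]
    (hAst : ∀ (i : ι) (v : V), v ∈ A → T i v ∈ A)
    (hAirr : ∀ W : Submodule ℚ V, W ≤ A → W ≠ ⊥ → (∀ (i : ι) (v : V), v ∈ W → T i v ∈ W) → W = A)
    (hsc : ∀ L : V →ₗ[ℚ] V, (∀ a ∈ A, L a ∈ A) → (∀ (i : ι) (a : V), a ∈ A → L (T i a) = T i (L a)) →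
      ∃ c : ℚ, ∀ a ∈ A, L a = c • a)
    {J : Type u} [Fintype J] [DecidableEq J] {b : J → V} (hb : ∀ j, b j ∈ A) (hli : LinearIndependent ℚ b) :
    Submodule.span ℚ (Set.range fun i : ι => fun j : J => T i (b j)) = Submodule.pi Set.univ (fun _ : J => A) := by
  -- the tuple space with its diagonal operators and cells
  let TJ : ι → (J → V) →ₗ[ℚ] (J → V) := fun i => (T i).compLeft J
  let N : J → Submodule ℚ (J → V) := fun j => A.map (LinearMap.single ℚ (fun _ : J => V) j)
  set 𝔐 := Submodule.span ℚ (Set.range fun i : ι => fun j : J => T i (b j)) with h𝔐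
  have hNst : ∀ (j : J) (i : ι) (f : J → V), f ∈ N j → TJ i f ∈ N j := fun j => (single_cell_irreducible T hAst hAirr j).1
  have hNirr : ∀ (j : J) (W : Submodule ℚ (J → V)), W ≤ N j → W ≠ ⊥ →
      (∀ (i : ι) (f : J → V), f ∈ W → TJ i f ∈ W) → W = N j := fun j => (single_cell_irreducible T hAst hAirr j).2
  haveI : ∀ j, FiniteDimensional ℚ (N j) := fun j => Module.Finite.map _ _
  have h𝔐st : ∀ (i : ι) (f : J → V), f ∈ 𝔐 → TJ i f ∈ 𝔐 := span_diag_orbit_stable T hmul b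
  have hpi : (⨆ j, N j) = Submodule.pi Set.univ (fun _ : J => A) := Submodule.iSup_map_single
  have h𝔐le : 𝔐 ≤ ⨆ j, N j := by
    rw [hpi, h𝔐, Submodule.span_le]
    rintro _ ⟨i, rfl⟩ j -
    exact hAst i _ (hb j)
  haveI : FiniteDimensional ℚ 𝔐 := Submodule.finiteDimensional_of_le h𝔐le
  -- a complementary family of cells
  obtain ⟨S, hdisj, hsup, -⟩ := exists_finset_compl_of_stable_le_iSup TJ hNst hNirr h𝔐st h𝔐le
  rw [← hpi]
  by_cases hS : S = ∅
  · subst hS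
    rw [Finset.sup_empty, sup_bot_eq] at hsup
    exact hsup
  exfalso
  obtain ⟨s, hs⟩ := Finset.nonempty_iff_ne_empty.2 hS
  -- the equivariant projection onto `S.sup N` along `𝔐`
  have hQst := stable_finset_sup TJ N hNst S
  obtain ⟨π, hπmem, hπid, hπzero, -, hπeq⟩ :=
    exists_proj_of_inf_eq_bot TJ hQst h𝔐st (by rw [inf_comm]; exact hdisj)
  have hsupQ : S.sup N ⊔ 𝔐 = ⨆ j, N j := by rw [sup_comm]; exact hsup
  have hQle : S.sup N ≤ Submodule.pi Set.univ (fun _ : J => A) := by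
    rw [← hpi]
    exact Finset.sup_le fun j _ => le_iSup N j
  -- the maps `L_j = proj_s ∘ π ∘ single_j` preserve `A` and commute with the `T_i` on `A`: scalars `c_j`
  have hsingle_mem : ∀ (j : J) (a : V), a ∈ A → LinearMap.single ℚ (fun _ : J => V) j a ∈ S.sup N ⊔ 𝔐 := by
    intro j a ha
    rw [hsupQ]
    exact Submodule.mem_iSup_of_mem j ⟨a, ha, rfl⟩
  have hL : ∀ j : J, ∃ c : ℚ, ∀ a ∈ A,
      (LinearMap.proj s ∘ₗ π ∘ₗ LinearMap.single ℚ (fun _ : J => V) j) a = c • a := by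
    intro j
    refine hsc _ (fun a ha => ?_) (fun i a ha => ?_)
    · have hmem : π (LinearMap.single ℚ (fun _ : J => V) j a) ∈ Submodule.pi Set.univ (fun _ : J => A) :=
        hQle (hπmem _)
      exact (Submodule.mem_pi.1 hmem) s trivial
    · simp only [LinearMap.coe_comp, Function.comp_apply, LinearMap.coe_proj, Function.eval]
      rw [← compLeft_single T i j a, hπeq i _ (hsingle_mem j a ha)]
      rfl
  choose c hc using hL
  -- `c_s = 1`: `π` is the identity on the cell `single_s(A) ≤ S.sup N`, and `b s ≠ 0`
  have hbs : b s ≠ 0 := hli.ne_zero s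
  have hcs : c s = 1 := by
    have h := hc s (b s) (hb s)
    have hid : (LinearMap.proj s ∘ₗ π ∘ₗ LinearMap.single ℚ (fun _ : J => V) s) (b s) = b s := by
      simp only [LinearMap.coe_comp, Function.comp_apply, LinearMap.coe_proj, Function.eval]
      rw [hπid _ ((Finset.le_sup hs : N s ≤ S.sup N) ⟨b s, hb s, rfl⟩)]
      simp
    rw [hid] at h
    have h' : (c s - 1) • b s = 0 := by rw [sub_smul, one_smul, ← h, sub_self]
    rcases smul_eq_zero.1 h' with h0 | h0
    · exact (sub_eq_zero.1 h0)
    · exact absurd h0 hbs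
  -- `π` kills the tuple `b ∈ 𝔐`; its `s`-coordinate is `Σ_j c_j b_j`
  obtain ⟨i₀, hi₀⟩ := h1
  have hbmem : (fun j => b j) ∈ 𝔐 := Submodule.subset_span ⟨i₀, funext fun j => by simp [hi₀]⟩
  have hsum : ∑ j, c j • b j = 0 := by
    have h0 : (LinearMap.proj s ∘ₗ π) (fun j => b j) = 0 := by
      simp only [LinearMap.coe_comp, Function.comp_apply, hπzero _ hbmem]
      rfl
    have hdec : (fun j => b j) = ∑ j, LinearMap.single ℚ (fun _ : J => V) j (b j) := by
      simp only [LinearMap.coe_single]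
      exact (LinearMap.sum_single_apply (fun _ : J => V) (fun j => b j)).symm
    rw [hdec, map_sum] at h0
    rw [← h0]
    refine Finset.sum_congr rfl fun j _ => ?_
    rw [← hc j (b j) (hb j)]
    rfl
  have hall := (Fintype.linearIndependent_iff.1 hli) c hsum s
  rw [hcs] at hall
  exact one_ne_zero hall

/-! ### §3 The dimension of a diagonal orbit module -/

/-- The tuples of elements of `A` form `A^J ≅ (J → A)`, of dimension `|J| · dim A`. [folklore] -/
theorem finrank_pi_const_eq {J : Type u} [Fintype J] (A : Submodule ℚ V) [FiniteDimensional ℚ A] :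
    Module.finrank ℚ ↥(Submodule.pi Set.univ (fun _ : J => A)) = Fintype.card J * Module.finrank ℚ A := by
  let e : (J → ↥A) ≃ₗ[ℚ] ↥(Submodule.pi Set.univ (fun _ : J => A)) :=
    { toFun := fun f => ⟨fun j => (f j : V), fun j _ => (f j).2⟩
      map_add' := fun f f' => rfl
      map_smul' := fun t f => rfl
      invFun := fun g j => ⟨(g : J → V) j, g.2 j trivial⟩
      left_inv := fun f => rfl
      right_inv := fun g => rfl }
  rw [← e.finrank_eq, Module.finrank_pi_fintype, Finset.sum_const, Finset.card_univ, smul_eq_mul]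

/-- **THE DIMENSION OF A DIAGONAL ORBIT MODULE: `dim 𝔐(b) = rank(b) · dim A`** for ANY tuple `b : J → A` (`A` stable
irreducible with scalar commutant, `T` closed under composition with identity), `rank(b) = dim span{b_j}`.
[cite: Lang2002, XVII §3] [cite: Serre1977, §2.6] -/
theorem finrank_span_diag_orbit_eq_mul (h1 : ∃ i₀ : ι, T i₀ = LinearMap.id)
    (hmul : ∀ i i' : ι, ∃ i'' : ι, T i'' = T i ∘ₗ T i') {A : Submodule ℚ V} [FiniteDimensional ℚ A]
    (hAst : ∀ (i : ι) (v : V), v ∈ A → T i v ∈ A)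
    (hAirr : ∀ W : Submodule ℚ V, W ≤ A → W ≠ ⊥ → (∀ (i : ι) (v : V), v ∈ W → T i v ∈ W) → W = A)
    (hsc : ∀ L : V →ₗ[ℚ] V, (∀ a ∈ A, L a ∈ A) → (∀ (i : ι) (a : V), a ∈ A → L (T i a) = T i (L a)) →
      ∃ c : ℚ, ∀ a ∈ A, L a = c • a)
    {J : Type u} [Fintype J] {b : J → V} (hb : ∀ j, b j ∈ A) :
    Module.finrank ℚ ↥(Submodule.span ℚ (Set.range fun i : ι => fun j : J => T i (b j))) =
      Module.finrank ℚ ↥(Submodule.span ℚ (Set.range b)) * Module.finrank ℚ A := by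
  -- a maximal linearly independent sub-tuple
  obtain ⟨κ, a, ha, hspan, hli⟩ := exists_linearIndependent' ℚ b
  haveI : Fintype κ := Fintype.ofInjective a ha
  -- the restriction to the sub-tuple maps `𝔐(b)` onto `𝔐(b ∘ a)` ...
  let ρ : (J → V) →ₗ[ℚ] (κ → V) := LinearMap.funLeft ℚ V a
  have hmap : (Submodule.span ℚ (Set.range fun i : ι => fun j : J => T i (b j))).map ρ =
      Submodule.span ℚ (Set.range fun i : ι => fun k : κ => T i (b (a k))) := by
    rw [Submodule.map_span, ← Set.range_comp]
    rfl
  -- ... injectively: an element `(φ b_j)_j` vanishing on the sub-tuple vanishes on `span{b_j}`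
  have hinj : ∀ f ∈ Submodule.span ℚ (Set.range fun i : ι => fun j : J => T i (b j)), ρ f = 0 → f = 0 := by
    intro f hf h0
    obtain ⟨φ, rfl⟩ := exists_linearMap_of_mem_span_diag_orbit T b hf
    have hker : ∀ x ∈ Submodule.span ℚ (Set.range (b ∘ a)), φ x = 0 := by
      intro x hx
      induction hx using Submodule.span_induction with
      | mem x hx =>
        obtain ⟨k, rfl⟩ := hx
        exact congrFun h0 k
      | zero => exact map_zero φ
      | add x y _ _ hx hy => rw [map_add, hx, hy, add_zero]
      | smul t x _ hx => rw [map_smul, hx, smul_zero]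
    funext j
    exact hker (b j) (by rw [hspan]; exact Submodule.subset_span ⟨j, rfl⟩)
  have hdim : Module.finrank ℚ ↥(Submodule.span ℚ (Set.range fun i : ι => fun j : J => T i (b j))) =
      Module.finrank ℚ ↥(Submodule.span ℚ (Set.range fun i : ι => fun k : κ => T i (b (a k)))) := by
    rw [← hmap, ← LinearMap.range_domRestrict]
    have hk : LinearMap.ker (ρ.domRestrict (Submodule.span ℚ (Set.range fun i : ι => fun j : J => T i (b j)))) = ⊥ := by
      rw [eq_bot_iff]
      intro f hf
      rw [Submodule.mem_bot]
      exact Subtype.ext (hinj f f.2 hf)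
    haveI : ∀ j : J, FiniteDimensional ℚ ↥(A.map (LinearMap.single ℚ (fun _ : J => V) j)) := fun j =>
      Module.Finite.map _ _
    haveI : FiniteDimensional ℚ ↥(Submodule.span ℚ (Set.range fun i : ι => fun j : J => T i (b j))) :=
      Submodule.finiteDimensional_of_le
        (show _ ≤ ⨆ j : J, A.map (LinearMap.single ℚ (fun _ : J => V) j) by
          rw [Submodule.iSup_map_single, Submodule.span_le]
          rintro _ ⟨i, rfl⟩ j -
          exact hAst i _ (hb j))
    have h := LinearMap.finrank_range_add_finrank_ker
      (ρ.domRestrict (Submodule.span ℚ (Set.range fun i : ι => fun j : J => T i (b j))))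
    rw [hk, finrank_bot, add_zero] at h
    exact h.symm
  -- density for the independent sub-tuple
  rw [hdim, span_diag_orbit_eq_pi_of_linearIndependent T h1 hmul hAst hAirr hsc (fun k => hb (a k)) hli,
    finrank_pi_const_eq, ← hspan, finrank_span_eq_card hli]

end Summit.HodgeConjecture.CorCM.IrrOdd

end
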